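import Summits.NavierStokesRegularity.NavierStokesRegularity.Theses.ScaledTopAlignment
import Summits.NavierStokesRegularity.NavierStokesRegularity.Theses.RecurrentProfiles
import Summits.NavierStokesRegularity.NavierStokesRegularity.Theses.ThreadingFlux
import Summits.NavierStokesRegularity.NavierStokesRegularity.Theorems.ScaledTopAlignmentMostTimesHardCoreMeet
import Summits.NavierStokesRegularity.NavierStokesRegularity.Theorems.RecurrentProfilesRecurrentReduction
import Summits.NavierStokesRegularity.NavierStokesRegularity.Theorems.RecurrentProfilesTargetOfCruxes
import Summits.NavierStokesRegularity.NavierStokesRegularity.Theorems.RecurrentProfilesAssembly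
import Summits.NavierStokesRegularity.NavierStokesRegularity.Theorems.RellichScarTypeIBlowupProfile
import HarnessLib

/-!
# Route `ScaledTopAlignment`, deciding crux W3ᵐᵗ = `AprioriMostTimesBulkAlignment`
# (stmt-NavierStokesRegularity-19551): the crux and the hard core «no Type-I blow-up» (stmt-1217) sit
# DOWNSTREAM of the recurrent Liouville theorem (stmt-NavierStokesRegularity-1589) — BY NAME

Strategist record (unit ns-sta-19551-cstrat-1, line `recurrent`). Pure compositions of landed theorems:

* `threadingFluxTarget_of_recurrentLiouville` — **RecurrentLiouville (1589) ⇒ Target (1217)**: if every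
  uniformly recurrent Albritton–Barker class profile with the Type-I rate is regular at the origin, then no
  classical Leray–Hopf solution from a rapidly decaying datum has a Type-I-rate first blow-up. Chain: no
  extension ⇒ maximal ⇒ a class profile singular at the origin (PROVED `typeIBlowupProfile_proof`, item 1591 —
  the `RellichScar` and `RecurrentProfiles` decls agree letter for letter) ⇒ a uniformly recurrent singular
  class profile with the same rate (PROVED `recurrentReduction_proof`, item 1590, through the PROVED glue
  `recurrentProfiles_targetOfCruxes_proof`, item 1593) ⇒ regular by the hypothesis — contradiction.
* `aprioriMostTimesBulkAlignment_of_recurrentLiouville_of_typeIIResidue` — **RecurrentLiouville ∧ R_II ⇒ W3ᵐᵗ**,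
  where `R_II` is the Type-II residue of the door (verbatim second conjunct of
  `aprioriMostTimesBulkAlignment_iff_target_and_typeII`): the composition of the strategist's line `recurrent`.
* `typeIIResidue_of_noTypeII` — the route's residual `NoTypeII` makes `R_II` vacuous; hence
  `aprioriMostTimesBulkAlignment_of_recurrentLiouville_of_noTypeII` — **RecurrentLiouville → NoTypeII → W3ᵐᵗ** —
  and `navierStokesRegularity_of_recurrentLiouville_of_noTypeII`: the route's `closes` factors through the
  pair (1589, 0056), i.e. through route RecurrentProfiles' `closes` with its proved items plugged.

WHAT THIS IS NOT: not NS regularity; nothing here proves or refutes W3ᵐᵗ, Target, RecurrentLiouville or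
NoTypeII — implications between OPEN statements, recorded so that «the Type-I content of the door has exactly
one live decomposition programme in the tree (crux 1589 and its lines)» is a kernel fact. [folklore]
-/

noncomputable section
-- the summit and its single sub-problem share the name (CONVENTIONS §1), as in every Theorems file
set_option linter.dupNamespace false
open MeasureTheory Set Filter Topology
open Literature.Analysis Literature.Analysis.FluidPDE

namespace Summit.NavierStokesRegularity.NavierStokesRegularity.Theorems

/-- **RecurrentLiouville (stmt-1589) ⇒ the hard core «no Type-I blow-up» (stmt-1217)**, BY NAME: if every
uniformly recurrent local-energy Type-I-rate profile is regular at the space–time origin, then every classical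
Leray–Hopf solution from a rapidly decaying datum with the Type-I rate at `T` extends classically past `T`.
Proof: otherwise the solution is maximal, `typeIBlowupProfile_proof` (item 1591) zooms it to a class profile
singular at the origin, `recurrentReduction_proof` (item 1590) + `recurrentProfiles_targetOfCruxes_proof`
(item 1593) make a uniformly recurrent singular one, which the hypothesis declares regular. [folklore] -/
theorem threadingFluxTarget_of_recurrentLiouville
    (hL : Summit.NavierStokesRegularity.NavierStokesRegularity.Theses.RecurrentProfiles.RecurrentLiouville) :
    Summit.NavierStokesRegularity.NavierStokesRegularity.Theses.ThreadingFlux.Target := by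
  intro ν T hν hT u p hcl hLH hdec hI
  by_contra hext
  have hP : Summit.NavierStokesRegularity.NavierStokesRegularity.Theses.RecurrentProfiles.TypeIBlowupProfile :=
    typeIBlowupProfile_proof
  obtain ⟨w, q, H, C, hsw, hgr, hIb, hdecay, hsing⟩ := hP ν T hν hT u p ⟨hcl, hext⟩ hLH hdec hI
  exact recurrentProfiles_targetOfCruxes_proof hL recurrentReduction_proof w q H C hsw hgr hIb hdecay hsing

/-- **RecurrentLiouville ⇒ NoTypeIRateProfile** (stmt-1589 ⇒ the RecurrentProfiles target stmt-1588), BY NAME —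
the proved glue `recurrentProfiles_targetOfCruxes_proof` with the proved reduction plugged: the recurrence
hypothesis of the crux is a free normalisation. [folklore] -/
theorem noTypeIRateProfile_of_recurrentLiouville
    (hL : Summit.NavierStokesRegularity.NavierStokesRegularity.Theses.RecurrentProfiles.RecurrentLiouville) :
    Summit.NavierStokesRegularity.NavierStokesRegularity.Theses.RecurrentProfiles.NoTypeIRateProfile :=
  recurrentProfiles_targetOfCruxes_proof hL recurrentReduction_proof

/-- **The strategist's line `recurrent`, composed** (sorry-free as an implication): the recurrent Liouville
theorem (stmt-1589) and the TYPE-II RESIDUE `R_II` of the door (the W3ᵐᵗ clause at every solution that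
neither extends past `T` nor has the Type-I rate) give the deciding crux W3ᵐᵗ (stmt-19551) BY NAME, through
`aprioriMostTimesBulkAlignment_iff_target_and_typeII`. [folklore] -/
theorem aprioriMostTimesBulkAlignment_of_recurrentLiouville_of_typeIIResidue
    (hL : Summit.NavierStokesRegularity.NavierStokesRegularity.Theses.RecurrentProfiles.RecurrentLiouville)
    (hR : ∀ (ν T : ℝ), 0 < ν → 0 < T → ∀ (u : ℝ → EuclideanSpace ℝ (Fin 3) → EuclideanSpace ℝ (Fin 3))
        (p : ℝ → EuclideanSpace ℝ (Fin 3) → ℝ),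
        IsClassicalNSSolutionOn (Set.Ico 0 T) ν 0 u p → IsLerayHopfOn T ν 0 (u 0) u →
        HasRapidSpatialDecay (u 0) → ¬ HasSmoothExtensionPast ν 0 u T → ¬ IsTypeIBlowup u T →
        ∃ lam0 : ℝ, lam0 < 1 ∧ ∃ R0 : ℝ, 0 < R0 ∧ ∃ θ : ℝ, θ < 1 ∧ ∀ κ : ℝ, 0 < κ → ∀ ε : ℝ, 0 < ε →
          ∀ δ : ℝ, 0 < δ → ∃ M : ℝ, 0 < M ∧ ∃ E : Set ℝ,
            (∃ h0 : ℝ, 0 < h0 ∧ ∀ h : ℝ, 0 < h → h < h0 →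
              volume (E ∩ Set.Ioo (T - h) T) ≤ ENNReal.ofReal (θ * h)) ∧
            ∀ t ∈ Set.Ico 0 T, t ∉ E → ∀ x : EuclideanSpace ℝ (Fin 3), M ≤ ‖curl (u t) x‖ →
              κ / (T - t) ≤ ‖curl (u t) x‖ →
              volume {y : EuclideanSpace ℝ (Fin 3) | lam0 * ‖curl (u t) x‖ ≤ ‖curl (u t) y‖ ∧
                  ‖x - y‖ ≤ R0 * Real.sqrt (ν / ‖curl (u t) x‖) ∧
                  ε < Real.sqrt (1 - (inner ℝ (‖curl (u t) x‖⁻¹ • curl (u t) x)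
                    (‖curl (u t) y‖⁻¹ • curl (u t) y)) ^ 2)}
                ≤ ENNReal.ofReal (δ * Real.sqrt (ν / ‖curl (u t) x‖) ^ 3)) :
    Summit.NavierStokesRegularity.NavierStokesRegularity.Theses.ScaledTopAlignment.AprioriMostTimesBulkAlignment :=
  aprioriMostTimesBulkAlignment_iff_target_and_typeII.mpr ⟨threadingFluxTarget_of_recurrentLiouville hL, hR⟩

/-- **The residual makes the Type-II residue vacuous**: under the route's `NoTypeII` (stmt-0056) a solution
that does not extend past `T` is maximal, hence has the Type-I rate, so the hypotheses of `R_II` are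
contradictory. [folklore] -/
theorem typeIIResidue_of_noTypeII
    (hII : Summit.NavierStokesRegularity.NavierStokesRegularity.Theses.ScaledTopAlignment.NoTypeII) :
    ∀ (ν T : ℝ), 0 < ν → 0 < T → ∀ (u : ℝ → EuclideanSpace ℝ (Fin 3) → EuclideanSpace ℝ (Fin 3))
        (p : ℝ → EuclideanSpace ℝ (Fin 3) → ℝ),
        IsClassicalNSSolutionOn (Set.Ico 0 T) ν 0 u p → IsLerayHopfOn T ν 0 (u 0) u →
        HasRapidSpatialDecay (u 0) → ¬ HasSmoothExtensionPast ν 0 u T → ¬ IsTypeIBlowup u T →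
        ∃ lam0 : ℝ, lam0 < 1 ∧ ∃ R0 : ℝ, 0 < R0 ∧ ∃ θ : ℝ, θ < 1 ∧ ∀ κ : ℝ, 0 < κ → ∀ ε : ℝ, 0 < ε →
          ∀ δ : ℝ, 0 < δ → ∃ M : ℝ, 0 < M ∧ ∃ E : Set ℝ,
            (∃ h0 : ℝ, 0 < h0 ∧ ∀ h : ℝ, 0 < h → h < h0 →
              volume (E ∩ Set.Ioo (T - h) T) ≤ ENNReal.ofReal (θ * h)) ∧
            ∀ t ∈ Set.Ico 0 T, t ∉ E → ∀ x : EuclideanSpace ℝ (Fin 3), M ≤ ‖curl (u t) x‖ →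
              κ / (T - t) ≤ ‖curl (u t) x‖ →
              volume {y : EuclideanSpace ℝ (Fin 3) | lam0 * ‖curl (u t) x‖ ≤ ‖curl (u t) y‖ ∧
                  ‖x - y‖ ≤ R0 * Real.sqrt (ν / ‖curl (u t) x‖) ∧
                  ε < Real.sqrt (1 - (inner ℝ (‖curl (u t) x‖⁻¹ • curl (u t) x)
                    (‖curl (u t) y‖⁻¹ • curl (u t) y)) ^ 2)}
                ≤ ENNReal.ofReal (δ * Real.sqrt (ν / ‖curl (u t) x‖) ^ 3) := by
  intro ν T hν hT u p hcl hLH hdec hext hnI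
  exact absurd (hII ν T hν hT u p ⟨hcl, hext⟩ hLH hdec) hnI

/-- **RecurrentLiouville → NoTypeII → W3ᵐᵗ** (stmt-1589 → stmt-0056 → stmt-19551), BY NAME: under the
route's residual, the open content of the door is at most the recurrent Liouville theorem. [folklore] -/
theorem aprioriMostTimesBulkAlignment_of_recurrentLiouville_of_noTypeII
    (hL : Summit.NavierStokesRegularity.NavierStokesRegularity.Theses.RecurrentProfiles.RecurrentLiouville)
    (hII : Summit.NavierStokesRegularity.NavierStokesRegularity.Theses.ScaledTopAlignment.NoTypeII) :
    Summit.NavierStokesRegularity.NavierStokesRegularity.Theses.ScaledTopAlignment.AprioriMostTimesBulkAlignment :=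
  aprioriMostTimesBulkAlignment_of_recurrentLiouville_of_typeIIResidue hL (typeIIResidue_of_noTypeII hII)

/-- **The route's `closes` factors through (1589, 0056)**: RecurrentLiouville → NoTypeII → Clay (A) — route
RecurrentProfiles' deciding theorem with its proved items (`recurrentReduction_proof`,
`ClayFromNoBlowup_holds`, `typeIBlowupProfile_proof`) plugged, equivalently
`navierStokesRegularity_of_target_of_noTypeII ∘ threadingFluxTarget_of_recurrentLiouville`. [folklore] -/
theorem navierStokesRegularity_of_recurrentLiouville_of_noTypeII
    (hL : Summit.NavierStokesRegularity.NavierStokesRegularity.Theses.RecurrentProfiles.RecurrentLiouville)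
    (hII : Summit.NavierStokesRegularity.NavierStokesRegularity.Theses.ScaledTopAlignment.NoTypeII) :
    _root_.NavierStokesRegularity :=
  navierStokesRegularity_of_target_of_noTypeII (threadingFluxTarget_of_recurrentLiouville hL) hII

end Summit.NavierStokesRegularity.NavierStokesRegularity.Theorems
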